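import Literature.Geometry.Kaehler.ComplexTorusLefschetzCokernelsPrincipal
import HarnessLib

/-!
# The Fourier transform on the integral HODGE lattices of a polarised torus and the Lefschetz operators:
# `F(Hdgᵖ(X, ℤ)) = Hdg^q(X̂, ℤ)`, `F(Hdgᵖ(X, ℤ) ∩ ker L_θ) = Hdg^{q+1}(X̂, ℤ) ∩ P(X̂, E_δ)`,
# `F(θ ∪ Hdgᵖ(X, ℤ)) = d₁d_g·Λ_{E_δ}(Hdg^{q+1}(X̂, ℤ))`, `[Hdg^{p+1}(X, ℤ) : θ ∪ Hdgᵖ(X, ℤ)] = [Hdg^q(X̂, ℤ) : d₁d_g·Λ_{E_δ}(Hdg^{q+1}(X̂, ℤ))]`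

[cite: Lange2023AbelianVarietiesComplex, §6.2.4 Prop. 6.2.20, Prop. 6.2.21 (pp. 310–311); §6.2.3 Prop. 6.2.18 (p. 308); §2.5.1 Prop. 2.5.1 (p. 131); §7.2.2]
[cite: Polishchuk2007FourierStable, §1 (p. 3)]
[cite: Voisin2002, §6.2.2 Lemma 6.24, Rem. 6.23; §7.1.2]
[cite: Lang1982AbelianFunctions, Ch. VII §5 Thm. 5.2 (pp. 119–120)]

Row g50-#9 of the `lit-hodgefound` p09 lineage: row g50-#7 (`ComplexTorusFourierLefschetzLattices`, the integral lattices `H•(X, ℤ)`)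
restricted to the INTEGRAL HODGE LATTICES `Hdgᵖ(X, ℤ) = H^{2p}(X, ℤ) ∩ H^{p,p}` (`integralHodgeClassesIn Φ (2p) p`; degrees are written
`2p`, `2p + 2`, `2q`, `2q + 2` throughout, `p + q + 1 = g`). SETTING as in rows g50-#4/#7: `θ = η = E` a Riemann form of type `(d₁, …, d_g)`
(`d : Fin (j + 2) → ℕ`, `g = j + 2`, any lattice basis), `F = fourierFormₗ Φ e`, `L_θ = lefschetzPow η 1` (`x ↦ θ ∧ x`, target degree
`2p + 2`), `E_δ = d₁d_g·E^*` the dual polarisation of `X̂`, `Λ_{E_δ} = lefschetzDual E_δ (2q)`, `P = primitiveForms E_δ (2q + 2)`.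

* §1 **`map_fourierFormₗ_integralHodgeClassesIn`: `F(Hdgᵖ(X, ℤ)) = Hdg^q(X̂, ℤ)`** (`p + q = g`) as an equality of subgroups (Prop. 6.2.20/6.2.21;
  the tree's `fourierForm_mem_integralHodgeClasses` / `exists_mem_integralHodgeClasses_fourierForm_eq` packaged, free degree bookkeeping).
* §2 **`IsPolarizationType.map_fourierFormₗ_integralHodgeClassesIn_inf_ker_lefschetzPow`:
  `F(Hdgᵖ(X, ℤ) ∩ ker L_θ) = Hdg^{q+1}(X̂, ℤ) ∩ P^{2q+2}(X̂, E_δ)`** (`2q + 2 ≤ g`).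
* §3 **`IsPolarizationType.map_fourierFormₗ_map_lefschetzPow_integralHodgeClassesIn`: `F(θ ∪ Hdgᵖ(X, ℤ)) = d₁d_g·Λ_{E_δ}(Hdg^{q+1}(X̂, ℤ))`.**
* §4 **`IsPolarizationType.relIndex_map_lefschetzPow_integralHodgeClassesIn_eq_dual`:
  `[Hdg^{p+1}(X, ℤ) : θ ∪ Hdgᵖ(X, ℤ)] = [Hdg^q(X̂, ℤ) : d₁d_g·Λ_{E_δ}(Hdg^{q+1}(X̂, ℤ))]`** (relative indices) — the cokernel of the Lefschetz
  operator on the integral Hodge classes of `X` has the order of the cokernel of `d₁d_g·Λ_{E_δ}` on the integral Hodge classes of `X̂`.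
* §5 **`IsPrincipalPolarization.relIndex_map_lefschetzPow_integralHodgeClassesIn_eq`**: for a PRINCIPAL polarisation (`g ≥ 2`),
  **`[Hdg^{p+1}(X, ℤ) : θ ∪ Hdgᵖ(X, ℤ)] = [Hdg^q(X, ℤ) : Λ_θ(Hdg^{q+1}(X, ℤ))]`** (`p + q + 1 = g`) — transported back to `X` along the
  isomorphism `φ_L = ρ(ᵗG)` (row g50-#8: `Λ_θ ∘ φ_H^* = φ_H^* ∘ Λ_{E^*}`, `φ_L^* Hdg•(X̂, ℤ) = Hdg•(X, ℤ)`).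

## References

* [cite: Lange2023AbelianVarietiesComplex, §6.2.4 Prop. 6.2.20, Prop. 6.2.21 (pp. 310–311); §6.2.3 Prop. 6.2.18 (p. 308); §2.5.1 Prop. 2.5.1; §7.2.2]
* [cite: Polishchuk2007FourierStable, §1 (p. 3)]
* [cite: Voisin2002, §6.2.2 Lemma 6.24, Rem. 6.23; §7.1.2]
-/

noncomputable section

-- `Module ℂ` / `SMulZeroClass ℂ` synthesis on `E [⋀^Fin k]→L[ℝ] ℂ` (as in `ComplexTorusLefschetzDecomposition`)
set_option maxSynthPendingDepth 3

open Module Function Complex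
open Literature.LinearAlgebra.Alternating

namespace Literature.Geometry.Kaehler.ComplexTorus

universe uE

/-! ## §0 Helpers -/

section Helpers

variable {ι : Type*} [Fintype ι] [LinearOrder ι] {E : Type uE} [NormedAddCommGroup E] [NormedSpace ℂ E]
  (Φ : (ι → ℝ) ≃L[ℝ] E)

omit [Fintype ι] [LinearOrder ι] in
/-- `θ^{∧1} = θ`. [folklore] -/
private theorem wedgePow_one_eq_self₁₁₀ (θ : E [⋀^Fin 2]→L[ℝ] ℂ) : wedgePow θ 1 = θ := by
  rw [wedgePow_one, Literature.Analysis.Complex.oneForm₀, ContinuousAlternatingMap.constOfIsEmpty_one_wedge]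
  ext v
  rfl

omit [Fintype ι] [LinearOrder ι] in
/-- The Lefschetz operator with target degree `b + 2` is `x ↦ θ ∧ x` re-indexed along `2 + b = b + 2`. [cite: Voisin2002, §6.2.1] -/
private theorem lefschetzPow_one_eq_domDomCongr_wedge₁₁₀ (η : E [⋀^Fin 2]→L[ℝ] ℝ) {b : ℕ} (hL : 2 * 1 + b = b + 2)
    (hp : 2 + b = b + 2) (x : E [⋀^Fin b]→L[ℝ] ℂ) :
    lefschetzPow η 1 hL x = ((ofRealForm η).wedge x).domDomCongr (finCongr hp) := by
  rw [lefschetzPow_apply, wedgePow_one_eq_self₁₁₀]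

/-- Re-reading the input degree of the Fourier transform along `p₁ = p₂`. [cite: Lange2023AbelianVarietiesComplex, §6.2.4 (6.11) (p. 311)] -/
private theorem fourierForm_domDomCongr₁₁₀ {N p₁ p₂ m : ℕ} (e : Fin N ≃ ι) (hp : p₁ = p₂) (h₁ : p₁ + m = N) (h₂ : p₂ + m = N)
    (z : E [⋀^Fin p₁]→L[ℝ] ℂ) : fourierForm Φ e h₂ (z.domDomCongr (finCongr hp)) = fourierForm Φ e h₁ z := by
  subst hp
  rfl

omit [Fintype ι] [LinearOrder ι] in
/-- Re-indexing is injective: `ψ.domDomCongr σ = 0 ↔ ψ = 0`. [folklore] -/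
private theorem domDomCongr_eq_zero_iff₁₁₀ {n m : ℕ} (σ : Fin n ≃ Fin m) (ψ : E [⋀^Fin n]→L[ℝ] ℂ) :
    ψ.domDomCongr σ = 0 ↔ ψ = 0 := by
  refine ⟨fun h ↦ ?_, fun h ↦ by rw [h]; ext v; rfl⟩
  ext v
  have hv := congrArg (fun φ : E [⋀^Fin m]→L[ℝ] ℂ ↦ φ (v ∘ σ.symm)) h
  simpa only [ContinuousAlternatingMap.domDomCongr_apply, Function.comp_assoc, Equiv.symm_comp_self, Function.comp_id,
    ContinuousAlternatingMap.coe_zero, Pi.zero_apply] using hv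

/-- `F` on the integral Hodge lattices with free degree bookkeeping: `F_e(Hdgᵖ(X, ℤ)) ⊆ Hdg^q(X̂, ℤ)` for `e : Fin N ≃ ι`,
`2p + 2q = N`, the lattices read in degrees `2p` and `2q`. [cite: Lange2023AbelianVarietiesComplex, §6.2.4 Prop. 6.2.20, Prop. 6.2.21 (pp. 310–311)] -/
theorem fourierForm_mem_integralHodgeClassesIn {N p q : ℕ} (e : Fin N ≃ ι) (h : 2 * p + 2 * q = N)
    {x : E [⋀^Fin (2 * p)]→L[ℝ] ℂ} (hx : x ∈ integralHodgeClassesIn Φ (2 * p) p) :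
    fourierForm Φ e h x ∈ integralHodgeClassesIn (dualPeriod Φ) (2 * q) q := by
  rw [fourierForm_eq_fourierForm_of_eq Φ e ((finCongr h).trans e) h rfl]
  exact fourierForm_mem_integralHodgeClasses Φ ((finCongr h).trans e) hx

/-- `F_e` maps `Hdgᵖ(X, ℤ)` ONTO `Hdg^q(X̂, ℤ)` (free degree bookkeeping). [cite: Lange2023AbelianVarietiesComplex, §6.2.4 Prop. 6.2.20, Prop. 6.2.21 (pp. 310–311)] -/
theorem exists_mem_integralHodgeClassesIn_fourierForm_eq {N p q : ℕ} (e : Fin N ≃ ι) (h : 2 * p + 2 * q = N)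
    {y : (E →L⋆[ℂ] ℂ) [⋀^Fin (2 * q)]→L[ℝ] ℂ} (hy : y ∈ integralHodgeClassesIn (dualPeriod Φ) (2 * q) q) :
    ∃ x ∈ integralHodgeClassesIn Φ (2 * p) p, fourierForm Φ e h x = y := by
  obtain ⟨x, hx, hxy⟩ := exists_mem_integralHodgeClasses_fourierForm_eq Φ ((finCongr h).trans e) hy
  exact ⟨x, hx, by rw [fourierForm_eq_fourierForm_of_eq Φ e ((finCongr h).trans e) h rfl]; exact hxy⟩

end Helpers

/-! ## §1 `F(Hdgᵖ(X, ℤ)) = Hdg^q(X̂, ℤ)` -/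

section Hodge

variable {ι : Type*} [Fintype ι] [LinearOrder ι] {E : Type uE} [NormedAddCommGroup E] [NormedSpace ℂ E]
  (Φ : (ι → ℝ) ≃L[ℝ] E)

/-- **`F(Hdgᵖ(X, ℤ)) = Hdg^q(X̂, ℤ)`, `p + q = g`**: the Fourier transform restricts to an isomorphism of the integral Hodge lattices
`H^{2p}(X, ℤ) ∩ H^{p,p} ⥲ H^{2q}(X̂, ℤ) ∩ H^{q,q}` (Prop. 6.2.20: `F(Hᵖ(X, ℤ)) = H^{2g−p}(X̂, ℤ)`; Prop. 6.2.21: `F(H^{p,q}) = H^{g−q,g−p}`),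
stated as an equality of subgroups of `H^{2q}(X̂, ℂ)` (injectivity is `fourierForm_injective`).
[cite: Lange2023AbelianVarietiesComplex, §6.2.4 Prop. 6.2.20, Prop. 6.2.21 (pp. 310–311)] -/
theorem map_fourierFormₗ_integralHodgeClassesIn {p q : ℕ} (e : Fin (2 * p + 2 * q) ≃ ι) :
    (integralHodgeClassesIn Φ (2 * p) p).map (fourierFormₗ Φ e).toAddMonoidHom = integralHodgeClassesIn (dualPeriod Φ) (2 * q) q := by
  ext y
  simp only [AddSubgroup.mem_map, LinearMap.toAddMonoidHom_coe, fourierFormₗ_apply]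
  constructor
  · rintro ⟨x, hx, rfl⟩
    exact fourierForm_mem_integralHodgeClassesIn Φ e rfl hx
  · intro hy
    exact exists_mem_integralHodgeClassesIn_fourierForm_eq Φ e rfl hy

end Hodge

/-! ## §2–§4 The Lefschetz operators on the Hodge lattices under `F` -/

section Lefschetz

variable {ι : Type*} [Fintype ι] [LinearOrder ι] {E : Type uE} [NormedAddCommGroup E] [NormedSpace ℂ E]
  [FiniteDimensional ℂ (E →L⋆[ℂ] ℂ)] (Φ : (ι → ℝ) ≃L[ℝ] E) {j : ℕ} {η : E [⋀^Fin 2]→L[ℝ] ℝ} {d : Fin (j + 2) → ℕ}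

/-- **`F(Hdgᵖ(X, ℤ) ∩ ker L_θ) = Hdg^{q+1}(X̂, ℤ) ∩ P^{2q+2}(X̂, E_δ)`** (`p + q + 1 = g`, `2q + 2 ≤ g`): the Fourier transform carries the integral
Hodge classes of codimension `p` killed by `θ ∪ ·` onto the integral Hodge classes of codimension `q + 1` on `X̂` that are `E_δ`-primitive
(`θ ∪ x = 0 ↔ F x ∈ P`, row g50-#4; `F(Hdgᵖ(X, ℤ)) = Hdg^{q+1}(X̂, ℤ)`).
[cite: Lange2023AbelianVarietiesComplex, §6.2.4 Prop. 6.2.20, Prop. 6.2.21 (pp. 310–311); §6.2.3 Prop. 6.2.18 (b)] [cite: Polishchuk2007FourierStable, §1 (p. 3)]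
[cite: Voisin2002, §6.2.2 Lemma 6.24; §7.1.2] -/
theorem IsPolarizationType.map_fourierFormₗ_integralHodgeClassesIn_inf_ker_lefschetzPow (hd : IsPolarizationType Φ η d)
    (hη : IsRiemannForm Φ η) {p q : ℕ} (hq : 2 * q ≤ j) (hL : 2 * 1 + 2 * p = 2 * p + 2)
    (e_b : Fin (2 * p + (2 * q + 2)) ≃ ι) :
    (integralHodgeClassesIn Φ (2 * p) p ⊓ (LinearMap.ker (lefschetzPow η 1 hL)).toAddSubgroup).map (fourierFormₗ Φ e_b).toAddMonoidHom =
      integralHodgeClassesIn (dualPeriod Φ) (2 * q + 2) (q + 1) ⊓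
        (primitiveForms (((d 0 * d (Fin.last (j + 1)) : ℕ) : ℝ) • dualForm Φ hη.1 hη.nondegenerate) (2 * q + 2)).toAddSubgroup := by
  have hqq : 2 * p + 2 * (q + 1) = 2 * p + (2 * q + 2) := by ring
  -- `θ ∧ x = 0 ↔ F x ∈ P`, for integral (hence rational) `x`
  have key : ∀ x : E [⋀^Fin (2 * p)]→L[ℝ] ℂ, x ∈ integralForms Φ (2 * p) →
      ((ofRealForm η).wedge x = 0 ↔ fourierForm Φ e_b rfl x ∈
        primitiveForms (((d 0 * d (Fin.last (j + 1)) : ℕ) : ℝ) • dualForm Φ hη.1 hη.nondegenerate) (2 * q + 2)) := by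
    intro x hx
    have h := hd.cupProduct_ratClass_eq_zero_iff_fourierForms_mem_primitiveForms Φ hη hq e_b
      ⟨x, mem_rationalForms_of_mem_integralForms Φ hx⟩
    rw [Subtype.ext_iff, coe_cupProduct_rfl, IsNSForm.coe_ratClass, Submodule.coe_zero, coe_fourierForms_apply] at h
    exact h
  ext y
  simp only [AddSubgroup.mem_map, AddSubgroup.mem_inf, Submodule.mem_toAddSubgroup, LinearMap.mem_ker,
    LinearMap.toAddMonoidHom_coe, fourierFormₗ_apply, lefschetzPow_one_eq_domDomCongr_wedge₁₁₀ η hL (by omega),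
    domDomCongr_eq_zero_iff₁₁₀]
  constructor
  · rintro ⟨x, ⟨hx, hx0⟩, rfl⟩
    exact ⟨fourierForm_mem_integralHodgeClassesIn Φ e_b hqq hx, (key x hx.1).1 hx0⟩
  · rintro ⟨hy, hyP⟩
    obtain ⟨x, hx, hxy⟩ := exists_mem_integralHodgeClassesIn_fourierForm_eq Φ e_b hqq hy
    subst hxy
    exact ⟨x, ⟨hx, (key x hx.1).2 hyP⟩, rfl⟩

/-- **`F(θ ∪ Hdgᵖ(X, ℤ)) = d₁d_g·Λ_{E_δ}(Hdg^{q+1}(X̂, ℤ))`** (`p + q + 1 = g`, every lattice basis, every frame `e_F`): the Fourier transform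
carries the image of the Lefschetz operator on the integral Hodge classes of codimension `p` of `X` onto the image of `d₁d_g·Λ_{E_δ}` on the
integral Hodge classes of codimension `q + 1` of `X̂` (row g50-#4 §2 `F(θ ∪ x) = −d₁d_g·Λ_{E_δ}(F x)`, and `F(Hdgᵖ(X, ℤ)) = Hdg^{q+1}(X̂, ℤ)`).
[cite: Polishchuk2007FourierStable, §1 (p. 3)] [cite: Lange2023AbelianVarietiesComplex, §6.2.4 Prop. 6.2.20, Prop. 6.2.21 (pp. 310–311); §6.2.3 Prop. 6.2.18 (b) (p. 308); §2.5.1 Prop. 2.5.1]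
[cite: Voisin2002, §6.2.2 Rem. 6.23; §7.1.2] -/
theorem IsPolarizationType.map_fourierFormₗ_map_lefschetzPow_integralHodgeClassesIn (hd : IsPolarizationType Φ η d)
    (hη : IsRiemannForm Φ η) {p q : ℕ} (hL : 2 * 1 + 2 * p = 2 * p + 2) (e_F : Fin ((2 * p + 2) + 2 * q) ≃ ι) :
    ((integralHodgeClassesIn Φ (2 * p) p).map (lefschetzPow η 1 hL).toAddMonoidHom).map (fourierFormₗ Φ e_F).toAddMonoidHom =
      (integralHodgeClassesIn (dualPeriod Φ) (2 * q + 2) (q + 1)).map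
        ((((d 0 * d (Fin.last (j + 1)) : ℕ) : ℂ)) •
          lefschetzDual (((d 0 * d (Fin.last (j + 1)) : ℕ) : ℝ) • dualForm Φ hη.1 hη.nondegenerate) (2 * q)).toAddMonoidHom := by
  have hcard : Fintype.card ι = 2 * (j + 2) := hd.card_eq
  have hpq : (2 * p + 2) + 2 * q = 2 * (j + 2) := by
    have h1 := Fintype.card_congr e_F
    simp only [Fintype.card_fin] at h1
    omega
  have hqq : 2 * p + 2 * (q + 1) = 2 * p + (2 * q + 2) := by ring
  -- auxiliary frames (the statement does not depend on them)
  let eₐ : Fin (2 + 2 * (j + 1)) ≃ ι := (Fintype.equivFinOfCardEq (by omega)).symm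
  let e_b : Fin (2 * p + (2 * q + 2)) ≃ ι := (Fintype.equivFinOfCardEq (by omega)).symm
  let Ê₂ : Fin ((2 * (j + 1) + (2 * q + 2)) + (2 + 2 * p)) ≃ ι ⊕ ι :=
    (Fintype.equivFinOfCardEq (by rw [Fintype.card_sum]; omega)).symm
  let ê : Fin (2 * q + (2 + 2 * p)) ≃ ι := (Fintype.equivFinOfCardEq (by omega)).symm
  let e_F' : Fin ((2 + 2 * p) + 2 * q) ≃ ι := (Fintype.equivFinOfCardEq (by omega)).symm
  -- `F(L_θ x) = −d₁d_g·Λ_{E_δ}(F x)` for integral (hence rational) `x`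
  have key : ∀ x : E [⋀^Fin (2 * p)]→L[ℝ] ℂ, x ∈ integralForms Φ (2 * p) →
      fourierForm Φ e_F rfl (lefschetzPow η 1 hL x) =
        -(((d 0 * d (Fin.last (j + 1)) : ℕ) : ℂ)) •
          lefschetzDual (((d 0 * d (Fin.last (j + 1)) : ℕ) : ℝ) • dualForm Φ hη.1 hη.nondegenerate) (2 * q)
            (fourierForm Φ e_b rfl x) := by
    intro x hx
    have h := hd.coe_fourierForms_cupProduct_ratClass Φ hη eₐ e_b Ê₂ ê e_F' ⟨x, mem_rationalForms_of_mem_integralForms Φ hx⟩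
    rw [coe_fourierForms_apply, coe_cupProduct_rfl, IsNSForm.coe_ratClass, coe_fourierForms_apply] at h
    rw [lefschetzPow_one_eq_domDomCongr_wedge₁₁₀ η hL (by omega) x,
      fourierForm_domDomCongr₁₁₀ Φ e_F (by omega : 2 + 2 * p = 2 * p + 2) (by omega) rfl,
      fourierForm_eq_fourierForm_of_eq Φ e_F e_F' (by omega) rfl]
    exact h
  ext z
  simp only [AddSubgroup.mem_map, LinearMap.toAddMonoidHom_coe, fourierFormₗ_apply, LinearMap.smul_apply, exists_exists_and_eq_and]
  constructor
  · rintro ⟨x, hx, rfl⟩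
    refine ⟨-fourierForm Φ e_b rfl x, neg_mem (fourierForm_mem_integralHodgeClassesIn Φ e_b hqq hx), ?_⟩
    rw [key x hx.1, map_neg, smul_neg, neg_smul]
  · rintro ⟨y, hy, rfl⟩
    obtain ⟨x, hx, hxy⟩ := exists_mem_integralHodgeClassesIn_fourierForm_eq Φ e_b hqq (neg_mem hy)
    refine ⟨x, hx, ?_⟩
    rw [key x hx.1, hxy, map_neg, smul_neg, neg_smul, neg_neg]

/-- **`[Hdg^{p+1}(X, ℤ) : θ ∪ Hdgᵖ(X, ℤ)] = [Hdg^q(X̂, ℤ) : d₁d_g·Λ_{E_δ}(Hdg^{q+1}(X̂, ℤ))]`** (`p + q + 1 = g`; relative indices, `0` if infinite):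
the cokernel of the Lefschetz operator `L_θ` on the INTEGRAL HODGE CLASSES of `X` and the cokernel of `d₁d_g·Λ_{E_δ}` on the integral Hodge
classes of `X̂` have the same order — `F` is injective, `F(Hdg^{p+1}(X, ℤ)) = Hdg^q(X̂, ℤ)` (§1) and
`F(θ ∪ Hdgᵖ(X, ℤ)) = d₁d_g·Λ_{E_δ}(Hdg^{q+1}(X̂, ℤ))` (§3). [cite: Lange2023AbelianVarietiesComplex, §6.2.4 Prop. 6.2.20, Prop. 6.2.21 (pp. 310–311)]
[cite: Polishchuk2007FourierStable, §1 (p. 3)] -/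
theorem IsPolarizationType.relIndex_map_lefschetzPow_integralHodgeClassesIn_eq_dual (hd : IsPolarizationType Φ η d)
    (hη : IsRiemannForm Φ η) {p q : ℕ} (hL : 2 * 1 + 2 * p = 2 * p + 2) (e_F : Fin ((2 * p + 2) + 2 * q) ≃ ι) :
    ((integralHodgeClassesIn Φ (2 * p) p).map (lefschetzPow η 1 hL).toAddMonoidHom).relIndex
        (integralHodgeClassesIn Φ (2 * p + 2) (p + 1)) =
      ((integralHodgeClassesIn (dualPeriod Φ) (2 * q + 2) (q + 1)).map
          ((((d 0 * d (Fin.last (j + 1)) : ℕ) : ℂ)) •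
            lefschetzDual (((d 0 * d (Fin.last (j + 1)) : ℕ) : ℝ) • dualForm Φ hη.1 hη.nondegenerate) (2 * q)).toAddMonoidHom).relIndex
        (integralHodgeClassesIn (dualPeriod Φ) (2 * q) q) := by
  have hF : (integralHodgeClassesIn Φ (2 * p + 2) (p + 1)).map (fourierFormₗ Φ e_F).toAddMonoidHom =
      integralHodgeClassesIn (dualPeriod Φ) (2 * q) q := by
    ext y
    simp only [AddSubgroup.mem_map, LinearMap.toAddMonoidHom_coe, fourierFormₗ_apply]
    constructor
    · rintro ⟨x, hx, rfl⟩
      exact fourierForm_mem_integralHodgeClassesIn Φ e_F (by ring) (p := p + 1) hx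
    · intro hy
      exact exists_mem_integralHodgeClassesIn_fourierForm_eq Φ e_F (by ring) (p := p + 1) hy
  rw [← hd.map_fourierFormₗ_map_lefschetzPow_integralHodgeClassesIn Φ hη hL e_F, ← hF,
    AddSubgroup.relIndex_map_map_of_injective _ _ (fourierForm_injective Φ e_F)]

end Lefschetz

/-! ## §5 Principal polarisations: `[Hdg^{p+1}(X, ℤ) : θ ∪ Hdgᵖ(X, ℤ)] = [Hdg^q(X, ℤ) : Λ_θ(Hdg^{q+1}(X, ℤ))]` -/

section Principal

variable {ι : Type*} [Fintype ι] [LinearOrder ι] {E : Type uE} [NormedAddCommGroup E] [NormedSpace ℂ E]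
  [FiniteDimensional ℂ E] [FiniteDimensional ℂ (E →L⋆[ℂ] ℂ)] (Φ : (ι → ℝ) ≃L[ℝ] E) {η : E [⋀^Fin 2]→L[ℝ] ℝ}

/-- **`[Hdg^{p+1}(X, ℤ) : θ ∪ Hdgᵖ(X, ℤ)] = [Hdg^q(X, ℤ) : Λ_θ(Hdg^{q+1}(X, ℤ))]` FOR A PRINCIPALLY POLARISED TORUS** (`p + q + 1 = g ≥ 2`, any
lattice basis, any frame; relative indices): the cokernel of the Lefschetz operator and the cokernel of its `sl₂`-partner `Λ_θ` on the
integral Hodge classes have the same order in complementary codimensions. §4 gives the Fourier form with `(X̂, E_δ)`; for the type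
`(1, …, 1)` one has `E_δ = E^*`, and `φ_L = ρ(ᵗG) : X ⥲ X̂` (`det G = 1`) pulls `Hdg•(X̂, ℤ)` back onto `Hdg•(X, ℤ)` (its analytic
representation `φ_H` is `ℂ`-linear) and `Λ_{E^*}` onto `Λ_θ` (row g50-#8).
[cite: Polishchuk2007FourierStable, §1 (p. 3)] [cite: Lange2023AbelianVarietiesComplex, §6.2.4 Prop. 6.2.20, Prop. 6.2.21 (pp. 310–311); §1.4.2 Lemma 1.4.5; §2.4.1; §7.3.3 Exercise (1)]
[cite: Lang1982AbelianFunctions, Ch. VII §5 Thm. 5.2] [cite: Voisin2002, §6.2.1 Lemma 6.19; §7.1.2] -/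
theorem IsPrincipalPolarization.relIndex_map_lefschetzPow_integralHodgeClassesIn_eq (hp : IsPrincipalPolarization Φ η)
    (hg : 4 ≤ Fintype.card ι) {p q : ℕ} (hL : 2 * 1 + 2 * p = 2 * p + 2) (e_F : Fin ((2 * p + 2) + 2 * q) ≃ ι) :
    ((integralHodgeClassesIn Φ (2 * p) p).map (lefschetzPow η 1 hL).toAddMonoidHom).relIndex
        (integralHodgeClassesIn Φ (2 * p + 2) (p + 1)) =
      ((integralHodgeClassesIn Φ (2 * q + 2) (q + 1)).map (lefschetzDual η (2 * q)).toAddMonoidHom).relIndex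
        (integralHodgeClassesIn Φ (2 * q) q) := by
  classical
  obtain ⟨g, d, hd, h1⟩ := hp.exists_type_eq_one
  have hcard := hd.card_eq
  obtain ⟨j, rfl⟩ : ∃ j, g = j + 2 := ⟨g - 2, by omega⟩
  have hη := hp.isRiemannForm
  -- the Fourier side (§4) with `D = 1`, `E_δ = E^*`
  rw [hd.relIndex_map_lefschetzPow_integralHodgeClassesIn_eq_dual Φ hη hL e_F]
  have hD : d 0 * d (Fin.last (j + 1)) = 1 := by rw [h1, h1]
  simp only [hD, Nat.cast_one, one_smul]
  -- `φ_L = ρ(ᵗG)` is an isomorphism with `ℂ`-linear analytic representation `φ_H`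
  obtain ⟨G, hG⟩ := hη.exists_intMatrix_latticeGram
  have hdet : G.transpose.det = 1 := by
    rw [Matrix.det_transpose, hd.det_intGram_eq_sq Φ hG]
    simp [h1]
  have hunit : IsUnit G.transpose.det := by rw [hdet]; exact isUnit_one
  have hBA : G.transpose⁻¹ * G.transpose = 1 := Matrix.nonsing_inv_mul _ hunit
  have hAB : G.transpose * G.transpose⁻¹ = 1 := Matrix.mul_nonsing_inv _ hunit
  have hρT : realRep Φ (dualPeriod Φ) G.transpose = (phiHRep Φ hη.1).restrictScalars ℝ := by
    refine ContinuousLinearMap.ext fun v ↦ ?_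
    rw [realRep_transposeGram_eq_phiHFun Φ hη.1 hG]
    rfl
  have hρρ' : ∀ w, realRep Φ (dualPeriod Φ) G.transpose (realRep (dualPeriod Φ) Φ G.transpose⁻¹ w) = w := fun w ↦ by
    rw [← ContinuousLinearMap.comp_apply, realRep_mul (dualPeriod Φ) Φ (dualPeriod Φ), hAB, realRep_one]
    rfl
  have hρ'ρ : ∀ v, realRep (dualPeriod Φ) Φ G.transpose⁻¹ (realRep Φ (dualPeriod Φ) G.transpose v) = v := fun v ↦ by
    rw [← ContinuousLinearMap.comp_apply, realRep_mul Φ (dualPeriod Φ) Φ, hBA, realRep_one]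
    rfl
  have hA : ∀ (c : ℂ) (u : E), realRep Φ (dualPeriod Φ) G.transpose (c • u) = c • realRep Φ (dualPeriod Φ) G.transpose u :=
    fun c u ↦ by rw [hρT, ContinuousLinearMap.coe_restrictScalars', map_smul]
  have hB : ∀ (c : ℂ) (w : E →L⋆[ℂ] ℂ),
      realRep (dualPeriod Φ) Φ G.transpose⁻¹ (c • w) = c • realRep (dualPeriod Φ) Φ G.transpose⁻¹ w := fun c w ↦ by
    calc realRep (dualPeriod Φ) Φ G.transpose⁻¹ (c • w)
        = realRep (dualPeriod Φ) Φ G.transpose⁻¹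
            (c • realRep Φ (dualPeriod Φ) G.transpose (realRep (dualPeriod Φ) Φ G.transpose⁻¹ w)) := by rw [hρρ']
      _ = realRep (dualPeriod Φ) Φ G.transpose⁻¹
            (realRep Φ (dualPeriod Φ) G.transpose (c • realRep (dualPeriod Φ) Φ G.transpose⁻¹ w)) := by rw [hA]
      _ = c • realRep (dualPeriod Φ) Φ G.transpose⁻¹ w := hρ'ρ _
  -- `φ_L^*` is injective on forms and carries `Hdg•(X̂, ℤ)` onto `Hdg•(X, ℤ)`
  have hinj : Injective (pullbackAlt (realRep Φ (dualPeriod Φ) G.transpose) (2 * q)).toAddMonoidHom := fun x y hxy ↦ by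
    have h := congrArg (fun z : E [⋀^Fin (2 * q)]→L[ℝ] ℂ ↦
      z.compContinuousLinearMap (realRep (dualPeriod Φ) Φ G.transpose⁻¹)) hxy
    simpa only [LinearMap.toAddMonoidHom_coe, pullbackAlt_apply,
      compContinuousLinearMap_realRep_realRep (dualPeriod Φ) Φ hAB] using h
  have hK : (integralHodgeClassesIn (dualPeriod Φ) (2 * q) q).map
        (pullbackAlt (realRep Φ (dualPeriod Φ) G.transpose) (2 * q)).toAddMonoidHom = integralHodgeClassesIn Φ (2 * q) q :=
    map_pullbackAlt_integralHodgeClasses_eq Φ (dualPeriod Φ) hBA hA hB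
  have hK' : (integralHodgeClassesIn (dualPeriod Φ) (2 * q + 2) (q + 1)).map
        (pullbackAlt (realRep Φ (dualPeriod Φ) G.transpose) (2 * q + 2)).toAddMonoidHom =
      integralHodgeClassesIn Φ (2 * q + 2) (q + 1) :=
    map_pullbackAlt_integralHodgeClasses_eq Φ (dualPeriod Φ) (p := q + 1) hBA hA hB
  -- `Λ_θ ∘ φ_L^* = φ_L^* ∘ Λ_{E^*}`
  have hH : ((integralHodgeClassesIn (dualPeriod Φ) (2 * q + 2) (q + 1)).map
        (lefschetzDual (dualForm Φ hη.1 hη.nondegenerate) (2 * q)).toAddMonoidHom).map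
          (pullbackAlt (realRep Φ (dualPeriod Φ) G.transpose) (2 * q)).toAddMonoidHom =
      (integralHodgeClassesIn Φ (2 * q + 2) (q + 1)).map (lefschetzDual η (2 * q)).toAddMonoidHom := by
    rw [AddSubgroup.map_map, ← hK', AddSubgroup.map_map]
    congr 1
    refine AddMonoidHom.ext fun y ↦ ?_
    simp only [AddMonoidHom.coe_comp, comp_apply, LinearMap.toAddMonoidHom_coe, pullbackAlt_apply, hρT]
    exact (hη.lefschetzDual_compContinuousLinearMap_phiHRep Φ y).symm
  rw [← AddSubgroup.relIndex_map_map_of_injective _ _ hinj, hH, hK]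

end Principal

end Literature.Geometry.Kaehler.ComplexTorus

end
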